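import Summits.MatrixMultiplication.OmegaCensus.STPP211CosetEngine

/-!
# (2,1,1)¹⁰ ⊄ (ℤ/2)⁶ — part D2: coset-law kernel decisions (#6, #10, #12, #13, #14, #26i)

Cell `pub-omega` (unit `pub-omega-stpp-1-g36`), topic `Summits/MatrixMultiplication/OmegaCensus`.
HONEST FRAMING (verbatim): lottery ticket; floor = certified bounds/negative ranges. Census STRUCTURE bookkeeping (B5, `T1((ℤ/2)⁶)`, Pb237);
nothing here is a bound on `ω`.

The `c`-code lists are representatives of the `AGL(6,2)`-classes of 10-subsets `C ∋ 0` of `𝔽₂⁶` (ENG2 g35's mass-formula-certified list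
`orbits_m6_k10.txt`; numbering = its line order). Classes of affine dimension `≤ 5` (all codes `< 32`): hyperplane «bit 5 = 0», threshold
`T = 10` (`csNN`). Classes #16, #24, #26 (affine dimension 6, nine of the ten points in the hyperplane «bit 0 = 0»): the nine EVEN codes,
threshold `T = 9` (`csNNi`). Each `decide +kernel` evaluates the SALTED search `T1CosetEng.searchS` (`STPP211CosetEngine`, v2); desk twins
`labm.c` / `engine_mirror.py` (HOME `pub-omega-stpp-1-g36/code/`) give the call counts quoted. The theorems these become: `STPP211Z2pow6CosetKills`
(via `STPP211CosetReflectB.cosetBound_of_searchS` and the coset law `STPP211CosetLaw`).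

References: H. Cohn, R. Kleinberg, B. Szegedy, C. Umans, FOCS 2005 (arXiv:math/0511460), Def. 5.1.
-/

namespace Summit.MatrixMultiplication.OmegaCensus

namespace T1CosetEng

/-- Class #6: the `c`-codes `0 1 2 3 4 8 15 16 23 27` (affine dimension ≤ 5). -/
def cs06 : List ℕ := [0, 1, 2, 3, 4, 8, 15, 16, 23, 27]

/-- KERNEL (93235 calls at the desk): no rooted admissible labeled set of class #6 in the hyperplane «bit 5 = 0» has 10 members. -/
theorem searchS_cs06 : searchS cs06 5 10 = true := by decide +kernel

/-- Class #10: the `c`-codes `0 1 2 4 7 8 11 16 21 25` (affine dimension ≤ 5). -/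
def cs10 : List ℕ := [0, 1, 2, 4, 7, 8, 11, 16, 21, 25]

/-- KERNEL (94678 calls at the desk): no rooted admissible labeled set of class #10 in the hyperplane «bit 5 = 0» has 10 members. -/
theorem searchS_cs10 : searchS cs10 5 10 = true := by decide +kernel

/-- Class #12: the `c`-codes `0 1 2 4 8 11 16 19 28 31` (affine dimension ≤ 5). -/
def cs12 : List ℕ := [0, 1, 2, 4, 8, 11, 16, 19, 28, 31]

/-- KERNEL (120410 calls at the desk): no rooted admissible labeled set of class #12 in the hyperplane «bit 5 = 0» has 10 members. -/
theorem searchS_cs12 : searchS cs12 5 10 = true := by decide +kernel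

/-- Class #13: the `c`-codes `0 1 2 4 8 14 16 17 22 23` (affine dimension ≤ 5). -/
def cs13 : List ℕ := [0, 1, 2, 4, 8, 14, 16, 17, 22, 23]

/-- KERNEL (109873 calls at the desk): no rooted admissible labeled set of class #13 in the hyperplane «bit 5 = 0» has 10 members. -/
theorem searchS_cs13 : searchS cs13 5 10 = true := by decide +kernel

/-- Class #14: the `c`-codes `0 1 2 4 8 14 16 22 26 28` (affine dimension ≤ 5). -/
def cs14 : List ℕ := [0, 1, 2, 4, 8, 14, 16, 22, 26, 28]

/-- KERNEL (68652 calls at the desk): no rooted admissible labeled set of class #14 in the hyperplane «bit 5 = 0» has 10 members. -/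
theorem searchS_cs14 : searchS cs14 5 10 = true := by decide +kernel

/-- Class #26: the nine EVEN codes `0 2 4 8 16 32 38 56 62` of `0 1 2 4 8 16 32 38 56 62` (the blocks whose `c` lies in «bit 0 = 0»). -/
def cs26i : List ℕ := [0, 2, 4, 8, 16, 32, 38, 56, 62]

/-- KERNEL (289009 calls at the desk): no rooted admissible labeled set for the nine inner blocks of class #26 in the hyperplane
«bit 0 = 0» has 9 members. -/
theorem searchS_cs26i : searchS cs26i 0 9 = true := by decide +kernel

end T1CosetEng

end Summit.MatrixMultiplication.OmegaCensus
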